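import Summits.BirchSwinnertonDyer.BirchSwinnertonDyer.Theses.ShaPrimaryTransfer
import Literature.NumberTheory.EllipticCurves.KubertTate1314ShaFive
import Literature.NumberTheory.EllipticCurves.KubertTate1314RankLe
import Literature.NumberTheory.EllipticCurves.KubertTate1314TwoDivisionField
import HarnessLib

/-!
# Route ShaPrimaryTransfer — the LOAD-BEARING cell `(E_{13/14}, 5, 2)` of T and the generic `2`-descent that would decide it

Helper for item stmt-BirchSwinnertonDyer-22356 (`FiniteShaComponentTransfer`, «T»; conjecture-grade at rank `≥ 2`) of route
`route-BirchSwinnertonDyer-ShaPrimaryTransfer`. BSD is NOT proved by any of this; T is not proved by any of this; no beyond-print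
theorem is claimed.

The census of seat g25 (evidence `Z10-VERDICT-g25.md`, `GENERIC2DESCENT-g25.md` on the item): T is load-bearing for `closes` only as
«door at an INADMISSIBLE prime ⟹ door at an ADMISSIBLE one» (and conversely the table's calibration needs BOTH entries decided), and NO
such cell at rank `≥ 2` is reachable with isogeny descents. The sharpest instance in the tree is the rank-`2` Kubert–Tate curve
`E = E_{13/14} = [1, −182, −2548, 0, 0]` (`369278a1`): its door at the admissible prime `5` is a THEOREM (`KubertTate1314ShaFive`:
`t₅(E) = 0`), while `t₂(E)` is undecided — `E` has NO rational `2`-torsion (`KubertTate1314TwoDivision.irreducible_twoDivision_1314`),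
so none of the tree's `2`-isogeny descents applies; the generic `2`-descent (`TwoDescentOneRoot*`, Cassels LMSST 24 §15) is the
instrument, and its algebraic half now gives an unconditional statement on this very curve.

* `transfer_five_two_1314` — **T's instance `(E, 5, 2)`: `t₅(E) = 0` (theorem) ⟹ `t₂(E) = 0`, read off T BY NAME** — the
  load-bearing cell, hypothesis discharged, conclusion open;
* `transfer_five_1314` — the same for every prime `q`;
* `eq_zero_of_two_nsmul_1314` — **`E(ℚ)[2] = 0`** (why the cell is not an isogeny-descent cell), from the irreducible `2`-division cubic via
  the generic-descent lemma `eq_zero_of_two_nsmul_eq_zero_of_indep` over `L = ℚ[X]/(Ψ₂/4)`;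
* `four_le_card_casselsBound_1314` — **unconditionally, every finite set `T ⊆ Lˣ/Lˣ²` containing the Cassels-map values `x(P) − Θ`
  of `E(ℚ)` has at least `4` elements** (`2^{rank} ≤ #T` with `rank E(ℚ) = 2`, tree `KubertTate1314Descent.mordellWeilRank_eq_two`):
  the generic `2`-descent of `E` is consistent and SHARP iff some admissible `T` has exactly `4` elements — the arithmetic half
  (`L(S,2)` of the cubic field, `S ⊇ {2, 7, 13, 2029}`) is what remains before `t₂(E)` can be decided.

References: J. W. S. Cassels, *Lectures on Elliptic Curves*, LMSST 24 (1991), §15; J. H. Silverman, *AEC*, Thm. X.4.2.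
-/

noncomputable section

set_option linter.dupNamespace false

open scoped Classical
open Polynomial

namespace Summit.BirchSwinnertonDyer.BirchSwinnertonDyer.Theorems.ShaPrimaryTransferGenericTwoDescent

open Summit.BirchSwinnertonDyer.BirchSwinnertonDyer.Theses.ShaPrimaryTransfer
open Literature.NumberTheory.EllipticCurves Literature.NumberTheory.EllipticCurves.KubertTate1314Descent
  Literature.NumberTheory.EllipticCurves.KubertTate1314TwoDivision
open WeierstrassCurve WeierstrassCurve.Affine WeierstrassCurve.Affine.Point

/-- `E_{13/14}` is an elliptic curve. -/
theorem isElliptic_E : (kubertTateFive (13 : ℚ) 14).IsElliptic :=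
  isElliptic_kubertTateFive_rat (by norm_num) (by norm_num)

/-- **T's load-bearing instance `(E_{13/14}, 5, 2)`**: the door at the admissible prime `5` is a theorem
(`KubertTate1314Descent.shaCorank_five_eq_zero`), so T BY NAME gives `t₂(E_{13/14}) = 0` — the conclusion no instrument of the tree
decides today. -/
theorem transfer_five_two_1314 (hT : FiniteShaComponentTransfer) : (kubertTateFive (13 : ℚ) 14).shaCorank 2 = 0 := by
  haveI := isElliptic_E
  haveI : Fact (Nat.Prime 5) := ⟨Nat.prime_five⟩
  haveI : Fact (Nat.Prime 2) := ⟨Nat.prime_two⟩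
  exact hT (kubertTateFive (13 : ℚ) 14) 5 2 shaCorank_five_eq_zero

/-- T BY NAME at every prime on `E_{13/14}`: `t_q(E_{13/14}) = 0` for all primes `q`, from the proved door at `5`. -/
theorem transfer_five_1314 (hT : FiniteShaComponentTransfer) (q : ℕ) [Fact q.Prime] :
    (kubertTateFive (13 : ℚ) 14).shaCorank q = 0 := by
  haveI := isElliptic_E
  haveI : Fact (Nat.Prime 5) := ⟨Nat.prime_five⟩
  exact hT (kubertTateFive (13 : ℚ) 14) 5 q shaCorank_five_eq_zero

/-- **`E_{13/14}(ℚ)[2] = 0`**: the `2`-division cubic is irreducible over `ℚ` (`irreducible_twoDivision_1314`), so by the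
generic-descent lemma `eq_zero_of_two_nsmul_eq_zero_of_indep` (independence of `1, Θ, Θ²` in `L = ℚ[X]/(Ψ₂/4)`) no rational point
has order `2` — no `2`-isogeny descent of the tree applies to this curve. Stated for an arbitrary `DecidableEq ℚ`. -/
theorem eq_zero_of_two_nsmul_1314 [inst : DecidableEq ℚ] (P : (kubertTateFive (13 : ℚ) 14).toAffine.Point)
    (h : 2 • P = 0) : P = 0 := by
  obtain rfl : inst = (fun a b ↦ Classical.propDecidable (a = b)) := Subsingleton.elim _ _
  letI : DecidableEq ℚ := fun a b ↦ Classical.propDecidable (a = b)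
  haveI := isElliptic_E
  haveI : Fact (Irreducible (X ^ 3 + C ((kubertTateFive (13 : ℚ) 14).b₂ / 4) * X ^ 2 +
      C ((kubertTateFive (13 : ℚ) 14).b₄ / 2) * X + C ((kubertTateFive (13 : ℚ) 14).b₆ / 4) : ℚ[X])) :=
    ⟨irreducible_twoDivision_1314⟩
  exact eq_zero_of_two_nsmul_eq_zero_of_indep (W := (kubertTateFive (13 : ℚ) 14).toAffine)
    (isTwoTorsionX_root (kubertTateFive (13 : ℚ) 14))
    (indep_of_le_natDegree_minpoly (natDegree_minpoly_root_eq_three (kubertTateFive (13 : ℚ) 14)).ge) P h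

/-- **Unconditionally: every Cassels bound for `E_{13/14}` has at least `4` elements.** For the cubic `2`-division field
`L = ℚ[X]/(Ψ₂/4)` and any finite `T ⊆ Lˣ/Lˣ²` containing all values `x(P) − Θ` of the Cassels map on `E_{13/14}(ℚ)`:
`4 ≤ #T` (`2^{rank} ≤ #T`, `KubertTate1314TwoDivision.pow_mordellWeilRank_1314_le_card`, with `rank E_{13/14}(ℚ) = 2`,
`KubertTate1314Descent.mordellWeilRank_eq_two`). The generic `2`-descent decides `t₂(E_{13/14})` the day an admissible `T` with
`#T = 4` and the local conditions are supplied — the arithmetic half that is not in the tree. -/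
theorem four_le_card_casselsBound_1314 [inst : DecidableEq ℚ]
    [Fact (Irreducible (X ^ 3 + C ((kubertTateFive (13 : ℚ) 14).b₂ / 4) * X ^ 2 +
      C ((kubertTateFive (13 : ℚ) 14).b₄ / 2) * X + C ((kubertTateFive (13 : ℚ) 14).b₆ / 4) : ℚ[X]))]
    [CharZero (AdjoinRoot (X ^ 3 + C ((kubertTateFive (13 : ℚ) 14).b₂ / 4) * X ^ 2 +
      C ((kubertTateFive (13 : ℚ) 14).b₄ / 2) * X + C ((kubertTateFive (13 : ℚ) 14).b₆ / 4) : ℚ[X]))]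
    [((kubertTateFive (13 : ℚ) 14).baseChange (AdjoinRoot (X ^ 3 + C ((kubertTateFive (13 : ℚ) 14).b₂ / 4) * X ^ 2 +
      C ((kubertTateFive (13 : ℚ) 14).b₄ / 2) * X + C ((kubertTateFive (13 : ℚ) 14).b₆ / 4) : ℚ[X]))).IsElliptic]
    (T : Finset (Additive (SqUnits (AdjoinRoot (X ^ 3 + C ((kubertTateFive (13 : ℚ) 14).b₂ / 4) * X ^ 2 +
      C ((kubertTateFive (13 : ℚ) 14).b₄ / 2) * X + C ((kubertTateFive (13 : ℚ) 14).b₆ / 4) : ℚ[X])))))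
    (hT : ∀ P : (kubertTateFive (13 : ℚ) 14).toAffine.Point,
      casselsMap (V := kubertTateFive (13 : ℚ) 14) _ (isTwoTorsionX_root (kubertTateFive (13 : ℚ) 14)) P ∈ T) :
    4 ≤ T.card := by
  have h := pow_mordellWeilRank_1314_le_card T hT
  have hr : (kubertTateFive (13 : ℚ) 14).mordellWeilRank = 2 := mordellWeilRank_eq_two
  rw [hr] at h
  norm_num at h
  exact h

end Summit.BirchSwinnertonDyer.BirchSwinnertonDyer.Theorems.ShaPrimaryTransferGenericTwoDescent

end
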